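import Summits.HubbardSuperconductivity.HubbardSuperconductivity.Theorems.BalabanIRBirGappedPhaseReductionThermal

/-!
# Route BalabanIR — crux 4 `BirGappedPhaseReduction` (item `stmt-HubbardSuperconductivity-2082`): the thermal reduction along a subsequence of inverse temperatures (dyadic Trotter numbers)

`BalabanIRBirGappedPhaseReductionThermal.lean` delivers the target's ground-eigenspace bound from a
lower bound on the canonical sector Gibbs average holding for ALL large `β`. A functional-integral
engine produces the bound at `β = M a` for the Trotter numbers `M` it controls, and the trace
Hölder step of the coercivity dictionary (`BalabanIRBirGappedPhaseReductionTraceHolder.lean`) is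
proved for dyadic `M = 2^{k+1}`. Since the sector Gibbs average CONVERGES as `β → ∞`
(`tendsto_sectorGibbs_atTop`), a bound holding FREQUENTLY in `β` (on any unbounded set of inverse
temperatures, e.g. `β_k = a 2^{k+1}`) already gives the same conclusion:

* `mul_re_trace_le_of_frequently_sectorGibbs` — abstract form (`∃ᶠ β in atTop`);
* `birTraceBound_of_frequently_thermal`, `birGroundStateAverageLRO_of_frequently_thermal`,
  `birGappedPhaseReduction_of_frequently_thermal` — the Hubbard-torus specialisations;
* `birGroundStateAverageLRO_of_thermal_dyadic` — the bound at `β = a · 2^{k+1}` for all large `k`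
  (some `a > 0`) suffices.

Sources: H. Tasaki, *Physics and Mathematics of Quantum Many-Body Systems* (2020), App. A;
folklore (limits along filters). No definition is introduced.
-/

noncomputable section

open scoped Matrix.Norms.L2Operator ComplexOrder MatrixOrder InnerProductSpace

namespace Summit.HubbardSuperconductivity.HubbardSuperconductivity.Theorems

open Matrix Filter Topology Literature.MathematicalPhysics.QuantumLattice
open Summit.HubbardSuperconductivity.HubbardSuperconductivity.Theses.BalabanIR

section SectorGibbs

variable {n : Type*} [Fintype n] [DecidableEq n]

/-- **Frequent thermal lower bounds pass to the ground-eigenspace average.** For a Hermitian `H`,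
an `H`-invariant subspace `K` with non-trivial sector ground eigenspace `E₀`, and any matrix `A`:
if `c ≤ Re (tr (P_K e^{-βH} A) / tr (P_K e^{-βH}))` for an unbounded set of `β`
(`∃ᶠ β in atTop`), then `c · re tr P_{E₀} ≤ re tr (P_{E₀} A)` — because the sector Gibbs average
converges as `β → ∞` (`tendsto_sectorGibbs_atTop`) and `{x | c ≤ x}` is closed.
Tasaki (2020) App. A. [folklore] -/
theorem mul_re_trace_le_of_frequently_sectorGibbs {H : Matrix n n ℂ} (hH : H.IsHermitian)
    (K : Submodule ℂ (n → ℂ)) (hinv : ∀ v ∈ K, H *ᵥ v ∈ K)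
    (hE₀ : K ⊓ Module.End.eigenspace (Matrix.toLin' H) ((H.minEnergyOn K : ℝ) : ℂ) ≠ ⊥)
    (A : Matrix n n ℂ) (c : ℝ)
    (h : ∃ᶠ β : ℝ in atTop, c ≤
      ((projMatrix (K.map ((WithLp.linearEquiv 2 ℂ (n → ℂ)).symm :
            (n → ℂ) →ₗ[ℂ] EuclideanSpace ℂ n)) * gibbsWeight β H * A).trace /
        (projMatrix (K.map ((WithLp.linearEquiv 2 ℂ (n → ℂ)).symm :
            (n → ℂ) →ₗ[ℂ] EuclideanSpace ℂ n)) * gibbsWeight β H).trace).re) :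
    c * (projMatrix ((K ⊓ Module.End.eigenspace (Matrix.toLin' H)
            ((H.minEnergyOn K : ℝ) : ℂ)).map ((WithLp.linearEquiv 2 ℂ (n → ℂ)).symm :
              (n → ℂ) →ₗ[ℂ] EuclideanSpace ℂ n))).trace.re ≤
      (projMatrix ((K ⊓ Module.End.eigenspace (Matrix.toLin' H)
            ((H.minEnergyOn K : ℝ) : ℂ)).map ((WithLp.linearEquiv 2 ℂ (n → ℂ)).symm :
              (n → ℂ) →ₗ[ℂ] EuclideanSpace ℂ n)) * A).trace.re := by
  have hlim := tendsto_sectorGibbs_atTop hH K hinv hE₀ A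
  set E₀ : Submodule ℂ (n → ℂ) := K ⊓ Module.End.eigenspace (Matrix.toLin' H)
    ((H.minEnergyOn K : ℝ) : ℂ) with hE₀def
  set P₀ := projMatrix (E₀.map ((WithLp.linearEquiv 2 ℂ (n → ℂ)).symm :
    (n → ℂ) →ₗ[ℂ] EuclideanSpace ℂ n)) with hP₀
  have hre := (Complex.continuous_re.tendsto _).comp hlim
  have h' : ∃ᶠ y : ℝ in 𝓝 (((P₀ * A).trace / P₀.trace).re), y ∈ Set.Ici c :=
    hre.frequently (h.mono fun β hβ => hβ)
  have hc : c ≤ ((P₀ * A).trace / P₀.trace).re := h'.mem_of_closed isClosed_Ici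
  have htr : P₀.trace = (Module.finrank ℂ E₀ : ℂ) := trace_projMatrix_map E₀
  have hm : (0 : ℝ) < (Module.finrank ℂ E₀ : ℝ) :=
    Nat.cast_pos.mpr (Submodule.one_le_finrank_iff.mpr hE₀)
  rw [htr, Complex.div_natCast_re] at hc
  rw [htr, Complex.natCast_re]
  exact (le_div_iff₀ hm).mp hc

end SectorGibbs

/-! ### The Hubbard torus -/

section Hubbard

open Literature.Probability.LatticeModels

/-- **Zero-temperature step from a frequent thermal bound, on the Hubbard torus.** As
`birTraceBound_of_eventually_thermal`, with the canonical `(2⌊(1-δ)L²/2⌋, S^z = 0)`-sector Gibbs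
bound `≥ c L⁴` only assumed on an unbounded set of inverse temperatures (`∃ᶠ β in atTop`).
Tasaki (2020) App. A. [folklore] -/
theorem birTraceBound_of_frequently_thermal (L : ℕ) [NeZero L] (t U δ c : ℝ) (hδ : -1 ≤ δ) :
    let N : ℕ := 2 * ⌊(1 - δ) * (L : ℝ) ^ 2 / 2⌋₊
    let H := hubbardTorus 2 L t U
    let S := szSector (Λ := FermionTorus 2 L) N 0
    let E₀ := S ⊓ Module.End.eigenspace (Matrix.toLin' H) ((H.minEnergyOn S : ℝ) : ℂ)
    let P := projMatrix (E₀.map (Fock.toEuclidean (ι := Orb (FermionTorus 2 L)) :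
      Fock (Orb (FermionTorus 2 L)) →ₗ[ℂ] EuclideanSpace ℂ (Finset (Orb (FermionTorus 2 L)))))
    let PS := projMatrix (S.map (Fock.toEuclidean (ι := Orb (FermionTorus 2 L)) :
      Fock (Orb (FermionTorus 2 L)) →ₗ[ℂ] EuclideanSpace ℂ (Finset (Orb (FermionTorus 2 L)))))
    let A := (pairField dWaveFormFactor L)ᴴ * pairField dWaveFormFactor L
    (∃ᶠ β : ℝ in atTop, c * (L : ℝ) ^ 4 ≤
        ((PS * gibbsWeight β H * A).trace / (PS * gibbsWeight β H).trace).re) →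
      c * (L : ℝ) ^ 4 * P.trace.re ≤ (P * A).trace.re := by
  intro N H S E₀ P PS A hth
  have hm : ⌊(1 - δ) * (L : ℝ) ^ 2 / 2⌋₊ ≤ Fintype.card (FermionTorus 2 L) := by
    have hcard : Fintype.card (FermionTorus 2 L) = L ^ 2 := by simp
    rw [hcard]
    apply Nat.floor_le_of_le
    have hL : (0 : ℝ) ≤ (L : ℝ) ^ 2 := by positivity
    push_cast
    nlinarith
  have hH : H.IsHermitian := LiebThm1.hamiltonian_isHermitian (fermionTorusGraph 2 L) t U
  have hinv : ∀ v ∈ S, H *ᵥ v ∈ S := fun v hv => hubbardTorus_mulVec_mem_szSector 2 L t U _ hv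
  have hE₀ : E₀ ≠ ⊥ := hubbardTorus_groundEigenspace_ne_bot 2 L t U hm
  exact mul_re_trace_le_of_frequently_sectorGibbs hH S hinv hE₀ A (c * (L : ℝ) ^ 4) hth

/-- **Thermal form of the target, frequent version.** If, for some `δ ∈ (0,1/2)`, an open window
`(U₁,U₂) ⊂ (0,∞)` and `c > 0`, for every `U` in the window, eventually in even `L`, the canonical
sector Gibbs average of `Δ_d† Δ_d` for `hubbardTorus 2 L 1 U` is `≥ c L⁴` on an unbounded set of
inverse temperatures `β`, then `BirGroundStateAverageLRO` holds. Tasaki (2020) App. A.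
[folklore] -/
theorem birGroundStateAverageLRO_of_frequently_thermal
    (h : ∃ δ ∈ Set.Ioo (0:ℝ) (1/2), ∃ U₁ U₂ c : ℝ, 0 < U₁ ∧ U₁ < U₂ ∧ 0 < c ∧
      ∀ U ∈ Set.Ioo U₁ U₂, ∃ L₀ : ℕ, ∀ (L : ℕ) [NeZero L], L₀ ≤ L → Even L →
        let N : ℕ := 2 * ⌊(1 - δ) * (L : ℝ) ^ 2 / 2⌋₊
        let H := hubbardTorus 2 L 1 U
        let S := szSector (Λ := FermionTorus 2 L) N 0
        let PS := projMatrix (S.map (Fock.toEuclidean (ι := Orb (FermionTorus 2 L)) :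
          Fock (Orb (FermionTorus 2 L)) →ₗ[ℂ] EuclideanSpace ℂ (Finset (Orb (FermionTorus 2 L)))))
        ∃ᶠ β : ℝ in atTop, c * (L : ℝ) ^ 4 ≤
          ((PS * gibbsWeight β H *
              ((pairField dWaveFormFactor L)ᴴ * pairField dWaveFormFactor L)).trace /
            (PS * gibbsWeight β H).trace).re) :
    BirGroundStateAverageLRO := by
  unfold BirGroundStateAverageLRO
  obtain ⟨δ, hδ, U₁, U₂, c, hU₁, hU₁₂, hc, h⟩ := h
  refine ⟨δ, hδ, U₁, U₂, c, hU₁, hU₁₂, hc, fun U hU => ?_⟩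
  obtain ⟨L₀, hL₀⟩ := h U hU
  refine ⟨L₀, fun L _ hL hLe => ?_⟩
  intro N H S E₀ P
  have hδ' : (-1 : ℝ) ≤ δ := by linarith [hδ.1]
  exact birTraceBound_of_frequently_thermal L 1 U δ c hδ' (hL₀ L hL hLe)

/-- **The reduction in frequent thermal form implies the item**: if the engine yields the sector
Gibbs bound `≥ c L⁴` on an unbounded set of `β` (on a window of couplings, eventually in even `L`),
then `BirGappedPhaseReduction` holds. Tasaki (2020) App. A. [folklore] -/
theorem birGappedPhaseReduction_of_frequently_thermal
    (h : BirComplexStableXY →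
      ∃ δ ∈ Set.Ioo (0:ℝ) (1/2), ∃ U₁ U₂ c : ℝ, 0 < U₁ ∧ U₁ < U₂ ∧ 0 < c ∧
      ∀ U ∈ Set.Ioo U₁ U₂, ∃ L₀ : ℕ, ∀ (L : ℕ) [NeZero L], L₀ ≤ L → Even L →
        let N : ℕ := 2 * ⌊(1 - δ) * (L : ℝ) ^ 2 / 2⌋₊
        let H := hubbardTorus 2 L 1 U
        let S := szSector (Λ := FermionTorus 2 L) N 0
        let PS := projMatrix (S.map (Fock.toEuclidean (ι := Orb (FermionTorus 2 L)) :
          Fock (Orb (FermionTorus 2 L)) →ₗ[ℂ] EuclideanSpace ℂ (Finset (Orb (FermionTorus 2 L)))))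
        ∃ᶠ β : ℝ in atTop, c * (L : ℝ) ^ 4 ≤
          ((PS * gibbsWeight β H *
              ((pairField dWaveFormFactor L)ᴴ * pairField dWaveFormFactor L)).trace /
            (PS * gibbsWeight β H).trace).re) :
    BirGappedPhaseReduction :=
  fun hE => birGroundStateAverageLRO_of_frequently_thermal (h hE)

/-- Dyadic inverse temperatures `β_k = a · 2^{k+1}`, `a > 0`, are unbounded: a property holding
for all large `k` at `β_k` holds frequently in `β → ∞`. [folklore] -/
theorem frequently_atTop_of_eventually_dyadic {p : ℝ → Prop} {a : ℝ} (ha : 0 < a)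
    (h : ∀ᶠ k : ℕ in atTop, p (a * 2 ^ (k + 1))) : ∃ᶠ β : ℝ in atTop, p β := by
  have hT : Tendsto (fun k : ℕ => a * (2 : ℝ) ^ (k + 1)) atTop atTop := by
    refine Tendsto.const_mul_atTop ha ?_
    exact (tendsto_pow_atTop_atTop_of_one_lt one_lt_two).comp (tendsto_add_atTop_nat 1)
  exact hT.frequently h.frequently

/-- **Thermal form of the target along dyadic Trotter numbers.** If, for some `δ ∈ (0,1/2)`, an
open window of couplings and `c > 0`, for every `U` in the window, eventually in even `L`, there is
a Trotter step `a > 0` such that the canonical sector Gibbs average of `Δ_d† Δ_d` at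
`β = a · 2^{k+1}` is `≥ c L⁴` for all large `k`, then `BirGroundStateAverageLRO` holds — the form
in which a functional integral with `M = 2^{k+1}` time slices, controlled uniformly in `M`,
delivers the target (`birGroundStateAverageLRO_of_frequently_thermal`). Tasaki (2020) App. A.
[folklore] -/
theorem birGroundStateAverageLRO_of_thermal_dyadic
    (h : ∃ δ ∈ Set.Ioo (0:ℝ) (1/2), ∃ U₁ U₂ c : ℝ, 0 < U₁ ∧ U₁ < U₂ ∧ 0 < c ∧
      ∀ U ∈ Set.Ioo U₁ U₂, ∃ L₀ : ℕ, ∀ (L : ℕ) [NeZero L], L₀ ≤ L → Even L →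
        let N : ℕ := 2 * ⌊(1 - δ) * (L : ℝ) ^ 2 / 2⌋₊
        let H := hubbardTorus 2 L 1 U
        let S := szSector (Λ := FermionTorus 2 L) N 0
        let PS := projMatrix (S.map (Fock.toEuclidean (ι := Orb (FermionTorus 2 L)) :
          Fock (Orb (FermionTorus 2 L)) →ₗ[ℂ] EuclideanSpace ℂ (Finset (Orb (FermionTorus 2 L)))))
        ∃ a : ℝ, 0 < a ∧ ∀ᶠ k : ℕ in atTop, c * (L : ℝ) ^ 4 ≤
          ((PS * gibbsWeight (a * 2 ^ (k + 1)) H *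
              ((pairField dWaveFormFactor L)ᴴ * pairField dWaveFormFactor L)).trace /
            (PS * gibbsWeight (a * 2 ^ (k + 1)) H).trace).re) :
    BirGroundStateAverageLRO := by
  obtain ⟨δ, hδ, U₁, U₂, c, hU₁, hU₁₂, hc, h⟩ := h
  refine birGroundStateAverageLRO_of_frequently_thermal ⟨δ, hδ, U₁, U₂, c, hU₁, hU₁₂, hc, ?_⟩
  intro U hU
  obtain ⟨L₀, hL₀⟩ := h U hU
  refine ⟨L₀, fun L _ hL hLe => ?_⟩
  intro N H S PS
  obtain ⟨a, ha, hk⟩ := hL₀ L hL hLe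
  exact frequently_atTop_of_eventually_dyadic (p := fun β => c * (L : ℝ) ^ 4 ≤
    ((PS * gibbsWeight β H * ((pairField dWaveFormFactor L)ᴴ * pairField dWaveFormFactor L)).trace /
      (PS * gibbsWeight β H).trace).re) ha hk

end Hubbard

end Summit.HubbardSuperconductivity.HubbardSuperconductivity.Theorems
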